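import Summits.BirchSwinnertonDyer.BirchSwinnertonDyer.Theses.TwoAdicConverse
import Literature.NumberTheory.Automorphic.ShimuraCurveRibetTakahashiOptimalModularityProofs
import Literature.NumberTheory.EllipticCurves.HeegnerPointsProofs
import Literature.NumberTheory.EllipticCurves.BSDSelmerPConverseYanZhuKolyvaginSystemProofs
import Literature.NumberTheory.EllipticCurves.BSDSelmerPConverse
import Literature.NumberTheory.EllipticCurves.NonvanishingTwistsBumpFriedbergHoffstein
import Literature.NumberTheory.EllipticCurves.BSDSelmerCMPConverseRankOneProofs
import Literature.NumberTheory.EllipticCurves.LeadingTerm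
import HarnessLib

/-!
# Route `TwoAdicConverse` (rung S3): the RESPLIT glue `RankOneTwoConverseGlueV2` PROVED

LANDING FILE v3 — the v2 family WAS installed 2026-08-28T≈02:40Z (route rev 19, operator via REQUESTS (137), by-hand variant = RUNBOOK §2 (b):
items 24622 V1′ · 24623 V2♭ (top-level cruxes, shared with KRR2) · glue item 24897 `RankOneTwoConverseGlueV2` (support); 23948/23949 asided; old glue 24406 stays CLOSED proved);
this file elaborates against rev 19 (planner re-check below). `Theses/TwoAdicConverse.lean` now carries the family
`KolyvaginNonvanishingAtTwoFrame` (= KRR2 item 24622, V1′) · `KolyvaginCorankLowerBoundAtTwo` (= KRR2 item 24623, V2♭) ·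
`RankOneTwoConverseOffBigImage` (24404) · `PrintedInputsRankOneAtTwo` (23951) · `NoTwoTorsionOverK` (24405) and the glue item
`RankOneTwoConverseGlueV2 : Prop := KolyvaginNonvanishingAtTwoFrame → KolyvaginCorankLowerBoundAtTwo → RankOneTwoConverseOffBigImage →
PrintedInputsRankOneAtTwo → NoTwoTorsionOverK → RankOneTwoConverse` (children in `--into` order; if the gate renders another order or
another glue name, permute the five `intro` names / rename the target below — nothing else changes).

The proof is the r = 1 branch of route KolyvaginRankRigidityAtTwo's rev-6 certified `closes` (planner-bsd-idea-1-g3-0, 2026-08-28T02:01:14Z)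
re-targeted at the crux `RankOneTwoConverse`; kernel-checked BEFORE the resplit against verbatim local copies of the five children in
`pub/bsd-2adic/plan/glue-19220-v2.lean` (`BSD2adicPlan.Split19220v2.rankOneTwoConverse_of_children_v2`: lean rc 0, 0 sorry).
On the habitat (2-adic image surjective): 2-parity gives w(E) = −1; Hoffstein–Luo gives a Heegner field K with 2 split and L(E^(d_K),1) ≠ 0,
so the partner has Sel-corank 0 (Kolyvagin–GZ finiteness); the FRAME (Dt, β, ι) comes from modularity (PrintedInputs conjunct 1) via the
PROVED `nonempty_modularParametrizationData_of_isNewformOf` and `exists_dvd_sq_sub_discr_holds`; V1′ gives a non-zero Kolyvagin class at 2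
in that frame, V2♭ (lower bound at minimal depth: ν + 1 ≤ c ∨ ν + 1 ≤ c′, with c = 1, c′ = 0) forces depth 0, i.e. y_K non-torsion;
Gross–Zagier over K and L(E/K) = L(E)·L(E^(d_K)) give analytic rank 1. Off the habitat: the residual child, verbatim.
Nothing is assumed beyond the item's own statement. BSD is not proved by any of this; the children carry all the content.
-/

set_option autoImplicit false
set_option linter.dupNamespace false

namespace Summit.BirchSwinnertonDyer.BirchSwinnertonDyer.Theorems

open scoped BigOperators Classical
open Literature

open Summit.BirchSwinnertonDyer.BirchSwinnertonDyer.Theses.TwoAdicConverse in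
/-- **Item `RankOneTwoConverseGlueV2` of route `TwoAdicConverse` holds.** -/
theorem twoAdicConverse_rankOneTwoConverseGlueV2_proof :
    Summit.BirchSwinnertonDyer.BirchSwinnertonDyer.Theses.TwoAdicConverse.RankOneTwoConverseGlueV2 := by
  unfold RankOneTwoConverseGlueV2
  intro hV1 hV2 hOff hIn hT
  unfold KolyvaginNonvanishingAtTwoFrame at hV1
  unfold KolyvaginCorankLowerBoundAtTwo at hV2
  unfold RankOneTwoConverseOffBigImage at hOff
  unfold PrintedInputsRankOneAtTwo at hIn
  unfold NoTwoTorsionOverK at hT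
  intro W _ _ hCM hred hc
  by_cases hsur : (∀ m : ℕ, W.HasSurjectiveModNGaloisRep (2 ^ m : ℕ))
  swap
  · exact hOff W hCM hred hsur hc
  obtain ⟨hmod, hHL, hpar, hKato, hE, hGZ, hrec⟩ := hIn
  haveI : Fact (Nat.Prime 2) := ⟨Nat.prime_two⟩
  haveI : NeZero (W.conductorNorm ℤ) := ⟨(W.conductorNorm_pos_holds).ne'⟩
  -- root number −1 from 2-parity (Dokchitser–Dokchitser) and corank 1
  have hw : W.rootNumber = -1 := by
    have h := hpar W
    unfold Literature.NumberTheory.EllipticCurves.p_parity at h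
    rw [hc, pow_one] at h
    exact h.symm
  -- Heegner field K with 2 split, d_K ≡ 1 (mod 8), and L(E^(d_K), 1) ≠ 0 (Hoffstein–Luo)
  obtain ⟨K, _, _, hK, -, hHN, hH2, hd8, hL1⟩ :=
    Literature.NumberTheory.EllipticCurves.exists_heegnerField_split_twist_ne_zero_discr_emod_eight_of_hoffsteinLuo
      hmod hHL W hw Nat.prime_two 0
  have hodd : Odd (NumberField.discr K) := by
    rw [Int.odd_iff]; omega
  have hne3 : NumberField.discr K ≠ -3 := by omega
  have hne4 : NumberField.discr K ≠ -4 := by omega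
  have h2d : ¬ ((2 : ℤ) ∣ NumberField.discr K) := by omega
  have hd : (NumberField.discr K : ℚ) ≠ 0 := by exact_mod_cast NumberField.discr_ne_zero K
  haveI := W.isElliptic_quadraticTwist hd
  -- the partner twist has L(1) ≠ 0, hence (Kolyvagin–Gross–Zagier finiteness) 2-Selmer corank 0
  obtain ⟨-, -, hfin⟩ := hKato (W.quadraticTwist (NumberField.discr K : ℚ)) hL1
  haveI := hfin
  have hc' : (W.quadraticTwist (NumberField.discr K : ℚ)).selmerCorank 2 = 0 :=
    (W.quadraticTwist (NumberField.discr K : ℚ)).selmerCorank_eq_zero_of_finite 2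
  have htor := hT W hsur K hK
  -- the FRAME (Dt, β, ι): modularity (PrintedInputs conjunct 1) ⇒ a parametrisation datum (PROVED supply);
  -- Heegner hypothesis ⇒ an orientation β with 4N ∣ β² − d_K; any embedding ι : K → ℂ
  obtain ⟨fW, hfW⟩ := hmod W
  obtain ⟨Dt⟩ :=
    Literature.NumberTheory.Automorphic.nonempty_modularParametrizationData_of_isNewformOf hfW
  obtain ⟨β, hβ⟩ :=
    Literature.NumberTheory.EllipticCurves.exists_dvd_sq_sub_discr_holds (W.conductorNorm ℤ) K hK hHN
  obtain ⟨ι⟩ := (inferInstance : Nonempty (K →+* ℂ))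
  -- V1′: a non-zero Kolyvagin class at 2 in this frame; take one of minimal depth
  obtain ⟨n, d, M, hn, hM1, hMle, hne⟩ := hV1 W hCM hred hsur K hK hHN hodd hne3 htor hH2 Dt β ι hβ
  obtain ⟨n₀, d₀, M₀, hn₀, hM₀, hM₀le, hne₀, hmin⟩ :=
    Literature.NumberTheory.EllipticCurves.heegnerSystem_exists_minimal_kolyvaginClass_ne_zero
      Nat.prime_two d hn hM1 hMle hne
  -- V2♭ (the ONLY use): ν + 1 ≤ c = 1 ∨ ν + 1 ≤ c′ = 0 forces ν = 0, i.e. y_K is non-torsion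
  have hstruct := hV2 W hCM hred hsur K hK hne3 hne4 h2d hHN Dt β ι n₀ d₀ M₀ hn₀ hM₀ hM₀le hne₀ hmin
  have hν : n₀.primeFactors.card = 0 := by
    rcases hstruct with h1 | h1 <;> omega
  have hn1 : n₀ = 1 := by
    rw [Finset.card_eq_zero, Nat.primeFactors_eq_empty] at hν
    rcases hν with h0 | h1
    · exact absurd (h0 ▸ hn₀.1) not_squarefree_zero
    · exact h1
  subst hn1
  -- Gross–Zagier over K: ord_(s=1) L(E/K, s) = 1, and L(E/K) = L(E) · L(E^(d_K)) with L(E^(d_K), 1) ≠ 0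
  have hEK : Literature.NumberTheory.EllipticCurves.analyticRankEK W K = 1 :=
    Literature.NumberTheory.EllipticCurves.heegnerSystem_analyticRankEK_eq_one_of_kolyvaginClass_one_ne_zero
      (hGZ W _ K) (hrec _ W K) hK rfl hHN d₀ hne₀
  rw [Literature.NumberTheory.EllipticCurves.analyticRankEK_eq_add_of hE W K,
    Literature.NumberTheory.EllipticCurves.analyticRank_eq_zero_of_entireLFunction_one_ne_zero _ hL1,
    add_zero] at hEK
  exact hEK

end Summit.BirchSwinnertonDyer.BirchSwinnertonDyer.Theorems
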